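import Literature.MathematicalPhysics.QuantumFieldTheory.Balaban1983to89.B8Prop5UniqKLevel

/-!
# `Balaban1983to89.B8Prop5UniqKLevelB` — [Balaban1985RegularSpaces] Proposition 5, THE UNIQUENESS CLAUSE (1.109) p. 94 at `k` levels:
# `pub-ymgap-dag-n04-b`'s converse-of-the-JOIN engine `B8Prop5UniqKLevel` §3/§6 RE-RUN WITH [4]'S LEFT-INVERSE LAW OF `G′` ASKED ON
# BOUNDED FUNCTIONS ONLY ([Balaban1985BackgroundPropagators] Thm 3.1 p. 397 as printed) — the W8″ typing repair of the uniqueness letters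

statement-level skeleton of published theorems with citation tags; proofs where landed; nothing here is a claim about the
Yang–Mills mass gap

PDF held: `paper:balaban1985-cmp99-regular-spaces-gauge-fixing` (journal page = PDF page + 74); pp. 92–94 [PDF 18–20] (Sect. D), p. 94 Proposition 5;
[4] = [Balaban1985BackgroundPropagators], Thm 3.1 p. 397, (3.24)–(3.25) p. 394.

WHY THIS FILE (cell `pub-ymgap`, HUMAN RULING D-0062; R134 acceleration seat `pub-ymgap-dag-n05-d` (g3), the UNIQUENESS twin of the LOCATED row (L1)
«Proposition 5 AS PRINTED at the member of record `zdLan`»).  The uniqueness chain of the N05 knit — `B8Prop5UniqKLevel.hFP_unique_of_cond179` →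
`B8Prop5UniqSectE.hFP_unique_of_sectE_local` → `B8SockP5uEAssembly` → the letters family `SLetU` of `B8LeafKnitZd3LettersRD` — displays [4]'s `G′` through
the TOTAL left-inverse law `g_left : ∀ x, G′(Δx + Q′ᵀ𝔄Q′x) = x` on ALL functions `ℤᵈ → 𝔸`.  At the members of record (`Ω 0 = univ`, where the
readings `hΔ`/`hqs` pin `Δ′ := Δ + Q′ᵀ𝔄Q′` everywhere) that law is NOT servable: the `Lᵏ`-periodic finite-range operator `Δ′` has unbounded
(Floquet) null vectors, so no total left inverse exists (INBOX W8″ of this seat's g2; dag-ref-A READ-24 (4): «`g_left` is applied at BOUNDED inputs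
only»).  In print `G′` is the inverse of `Δ′` with Dirichlet conditions ON FUNCTIONS ON `Ω₀` measured in weighted sup norms ([4] Thm 3.1 p. 397,
B8 (1.95) p. 92) — i.e. a two-sided inverse on BOUNDED functions.  THIS FILE re-types the one binder accordingly and re-runs the two engine
theorems that consume it:
* §1 `proj325_eq_zero_of_multiplier_guarded` — n04-b's «R f = 0 ⟸ Δf = Q′*μ» (`proj325_eq_zero_of_multiplier'`) with the left-inverse law asked
  on a predicate `P` containing `f` (abstract modules).
* §2 **`isFixedPoint_of_cond179_bdd`**, **`hFP_unique_of_cond179_bdd`** — n04-b's §6 VERBATIM with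
  `g_leftB : ∀ x, (∃ C, ∀ y, ‖x y‖ ≤ C) → G′(Δx + Q′ᵀ𝔄Q′x) = x` in place of `g_left`; the law is applied at the D*-identity's right-hand side
  `N = W + Δλ_t + VΔλ_t` — `Bd2`-bounded by the engine's own `hW`/`bd2_covLap_lamOf`/`hVbd`, hence sup-bounded at level `0` (`Ω 0 = univ`) —
  and at `λ_t` (`‖λ_t‖ ≤ ‖t‖`).
Consumers: `B8Prop5UniqSectEW` (the uniqueness JOIN at print's generality — Λ_j-witnesses for `u₁` instead of Theorem 4's datum — over this
engine), then `B8Prop5UniqueZdLan` (`B8.Prop5Unique (zdLan L B₁ ∘ cut)` modulo the guarded uniqueness letters).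

HONEST SCOPE.  A typing repair (one displayed law WEAKENED to its printed domain) + re-run; nothing of [4], of Sect. E or of the contraction is
proved here beyond n04-b's composition; all other binders, windows and conclusions byte-identical to `B8Prop5UniqKLevel` §6.  Count-neutral;
N05 NOT discharged; one finite T⁴ programme at fixed ε; nothing continuum / ℝ⁴ / OS / mass-gap / Clay.  Unit `pub-ymgap-dag-n05-d` (g3),
2026-08-27.  Tree API by name only, nothing restated.
-/

noncomputable section

open NormedSpace Metric Set Filter Topology
open Complex (I)

namespace Literature.MathematicalPhysics.QuantumFieldTheory.Balaban1983to89.B8Prop5UniqKLevelB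

open B7Prop1Explicit (e U1)
open B7Prop2Explicit (unitaryUnits unitaryUnits_le_U1)
open B7Eq78Linearization (conjR)
open B7Eq167Flat (Cond167)
open B8Ineq132 (covDerivFwd covDeriv norm_conjR)
open B8Eq119TwistedAxial (Restr129)
open B8Eq138LandauZd (covLap covDivB QT covLap_zero)
open B8Eq178Averages (util178 Qnl Cond179 restr129_mul_iff_cond179)
open B8Eq182Proof (gAd)
open B8Eq184Proof (gaugeExp)
open B8Eq188Proof (frakF3 gAd_neg gAd_add)
open B8SectDSource (fixedPoint_closedBall)
open B8LambdaSpaceKLevel (wt wt_pos wt_nonneg lamSubK lamOf lamOf_sub norm_lamOf_le weight_mul_norm_covDerivFwd_le mkLam lamOf_mkLam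
  norm_mkLam_le norm_le_iff norm_sub_le_iff covDerivFwd_add' covDerivFwd_sub')
open B8Prop5ContractionKLevel (Bd2 Zsol Vop Wsrc PsiP5 Mc Kc mWc mWc_nonneg propFive_fixedPoint_kLevel zsol_eq bd2_zsol Vop_sub norm_Vop_le
  wt_sq_norm_Wsrc_le)
open B8Prop5GaugeParamKLevel (gpar_size gpar_grad gpar_lip norm_covDeriv_eq)
open B8Prop5KLevelLetters (dstar_rhs_eq_W_add covLap_sub)
open B8Restr129Inversion (restr129_mul_iff_inv_mul)
open B8Eq195Linear (proj325_sub)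
open B8Prop5JoinHFP (covLap_neg')
open B8Prop5UniqKLevel (sectE_inverse_kLevel bd2_covLap_lamOf neumann_injective)

-- `Site` alone could resolve to the torus sites of `Setup.lean`; re-export the `ℤ^d` sites of `B7Prop1Explicit`.
export B7Prop1Explicit (Site)

variable {d : ℕ} {𝔸 : Type*} [CStarAlgebra 𝔸] [Nontrivial 𝔸]

/-! ## §1 «R f = 0 ⟸ Δf = Q′*μ» with the left-inverse law of `G′` on a GUARD containing `f` -/

section Proj

variable {E F : Type*} [AddCommGroup E] [Module ℂ E] [AddCommGroup F] [Module ℂ F]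

/-- **«R f = 0» from the multiplier form, guarded left inverse** — n04-b's `B8Prop5UniqKLevel.proj325_eq_zero_of_multiplier'` VERBATIM except that the
left-inverse law of `G′` for `Δ′ = Δ + Q′*𝔄Q′` is asked only on a predicate `P` (the bounded functions, in the application), and `P f` is a hypothesis:
if `Δf = Q′*μ` then `f = G′Q′*(μ + 𝔄Q′f)` and `Q′*CQ′G′f = Q′*(μ + 𝔄Q′f)` (`c_left'`), hence `f − G′Q′*CQ′G′f = 0`.
[cite: Balaban1985BackgroundPropagators, (3.25) p.394, Thm 3.1 p.397; Balaban1985RegularSpaces, (1.38) p.82, (1.95) p.92] -/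
theorem proj325_eq_zero_of_multiplier_guarded (g Δ : E →ₗ[ℂ] E) (q : E →ₗ[ℂ] F) (qs : F →ₗ[ℂ] E) (Aw c : F →ₗ[ℂ] F) {P : E → Prop}
    (g_leftP : ∀ x, P x → g (Δ x + qs (Aw (q x))) = x) (c_left' : ∀ φ, qs (c (q (g (g (qs φ))))) = qs φ)
    {f : E} (hf : P f) {μ : F} (h : Δ f = qs μ) : f - g (qs (c (q (g f)))) = 0 := by
  have hf' : f = g (qs (μ + Aw (q f))) := by
    have := g_leftP f hf
    rw [h, ← map_add] at this
    exact this.symm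
  have h1 : qs (c (q (g f))) = qs (μ + Aw (q f)) := by
    conv_lhs => rw [hf']
    exact c_left' _
  rw [h1, ← hf', sub_self]

end Proj

/-! ## §2 The converse of JOIN-B and Proposition 5's uniqueness clause with the guarded left-inverse law -/

section Converse179B

variable {L k : ℕ} {η : ℝ} {Ω Λs : ℕ → Set (Site d)} {Eb : ℕ → Set (Site d × Fin d)} {U₀ : Site d → Fin d → 𝔸ˣ}
  {A : Site d → Fin d → 𝔸} {u₁ : Site d → 𝔸ˣ}

/-- **THE CONVERSE OF JOIN-B, ROUTE-AGNOSTIC, WITH [4]'S LEFT-INVERSE LAW OF `G′` ON BOUNDED FUNCTIONS ONLY** —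
`B8Prop5UniqKLevel.isFixedPoint_of_cond179` (seat `pub-ymgap-dag-n04-b` g5) VERBATIM except that the TOTAL law `g_left : ∀ x, G′(Δx + Q′ᵀ𝔄Q′x) = x` is
re-typed as `g_leftB`: the identity is asked only for SUP-BOUNDED `x` ([Balaban1985BackgroundPropagators] Thm 3.1 p. 397: `G′ = (Δ′_{Ω₀})⁻¹` on the
space of functions on `Ω₀` with the weighted sup norms — on `ℤᵈ → 𝔸` at `Ω 0 = univ` the total law has no model, the `Lᵏ`-periodic finite-range `Δ′`
having unbounded null vectors; INBOX W8″ of seat `pub-ymgap-dag-n05-d` g2, dag-ref-A READ-24 (4)).  The engine applies the law at three BOUNDED inputs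
only: the D*-identity's right-hand side `N = W + Δλ_t + VΔλ_t` (`Bd2`-bounded by the engine's own `hW`, `bd2_covLap_lamOf`, `hVbd`; a sup bound at
level `0` since `Ω 0 = univ`) and `λ_t` (`‖λ_t‖ ≤ ‖t‖`), so the proof is n04-b's with two boundedness certificates inserted.  Everything else —
binders, windows, conclusion — byte-identical. [cite: Balaban1985RegularSpaces, Prop. 5 (1.107)–(1.109) p.94, (1.93)–(1.100) pp.92–93, (1.79) p.90, (1.113)–(1.114) p.95; Balaban1985BackgroundPropagators, Thm 3.1 p.397, (3.25) p.394] -/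
theorem isFixedPoint_of_cond179_bdd (hL : 1 ≤ L) (hη : 0 < η) (hU₀ : ∀ x κ, U₀ x κ ∈ unitaryUnits 𝔸) (hΩ0 : Ω 0 = Set.univ)
    (hEbΩ : ∀ j, j ≤ k → ∀ x ∈ Ω j, ∀ μ : Fin d, (x, μ) ∈ Eb j ∧ (x - e μ, μ) ∈ Eb j)
    -- letters of [4]
    (g Δ : (Site d → 𝔸) →ₗ[ℂ] (Site d → 𝔸)) (q : (Site d → 𝔸) →ₗ[ℂ] (ℕ → Site d → 𝔸)) (qs : (ℕ → Site d → 𝔸) →ₗ[ℂ] (Site d → 𝔸))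
    (Aw c : (ℕ → Site d → 𝔸) →ₗ[ℂ] (ℕ → Site d → 𝔸))
    (g_leftB : ∀ x : Site d → 𝔸, (∃ C : ℝ, ∀ y, ‖x y‖ ≤ C) → g (Δ x + qs (Aw (q x))) = x)
    (c_left' : ∀ φ, qs (c (q (g (g (qs φ))))) = qs φ)
    (hΔ : ∀ (f : Site d → 𝔸), ∀ x ∈ Ω 0, Δ f x = covLap η U₀ ((Ω 0).indicator f) x)
    (hqs : ∀ (μ : ℕ → Site d → 𝔸), ∀ x ∈ Ω 0, qs μ x = QT L k Λs U₀ μ x)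
    -- the Sect. E correction `H_c` (λ′ = λ + H_c λ) and the windows
    (Hc : (Site d → 𝔸) → (Site d → 𝔸))
    {α₄ BR h₀ h₁ h₂ l₀ l₁ cA cDA ρ : ℝ}
    (hBR : 0 ≤ BR) (hh₀ : 0 ≤ h₀) (hh₂ : 0 ≤ h₂) (hcA : 0 ≤ cA) (hcA' : cA ≤ 1 / 13) (hcDA : 0 ≤ cDA)
    (ha₁' : α₄ / 4 + h₀ ≤ 1 / 24) (hb₁' : α₄ / 4 + h₁ ≤ 1 / 140) (hb₁ : 0 < α₄ / 4 + h₁) (hθ : 10 * (α₄ / 4 + h₀) * BR ≤ 1 / 2)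
    (hl₀' : l₀ ≤ 1 / 2) (hl₁' : l₁ ≤ 1 / 2) (hρ₀ : ρ + h₀ ≤ α₄ / 4) (hρ₁ : ρ + h₁ ≤ α₄ / 4)
    -- (1.98)R
    (hRbd : ∀ (f : Site d → 𝔸) (m : ℝ), 0 ≤ m → Bd2 L η k Ω f m → Bd2 L η k Ω (f - g (qs (c (q (g f))))) (BR * m))
    -- the binders of `H_c`
    (hc0 : ∀ s : lamSubK η U₀ L k Eb, ‖s‖ ≤ α₄ / 4 → ∀ x, ‖Hc (lamOf s) x‖ ≤ h₀)
    (hc1 : ∀ s : lamSubK η U₀ L k Eb, ‖s‖ ≤ α₄ / 4 → ∀ j, j ≤ k → ∀ p ∈ Eb j, wt L η j * ‖covDerivFwd η U₀ p.2 (Hc (lamOf s)) p.1‖ ≤ h₁)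
    (hc2 : ∀ s : lamSubK η U₀ L k Eb, ‖s‖ ≤ α₄ / 4 → Bd2 L η k Ω (covLap η U₀ (Hc (lamOf s))) h₂)
    (hcL0 : ∀ s t : lamSubK η U₀ L k Eb, ‖s‖ ≤ α₄ / 4 → ‖t‖ ≤ α₄ / 4 → ∀ x, ‖Hc (lamOf s) x - Hc (lamOf t) x‖ ≤ l₀ * ‖s - t‖)
    (hcL1 : ∀ s t : lamSubK η U₀ L k Eb, ‖s‖ ≤ α₄ / 4 → ‖t‖ ≤ α₄ / 4 → ∀ j, j ≤ k → ∀ p ∈ Eb j,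
      wt L η j * ‖covDerivFwd η U₀ p.2 (Hc (lamOf s) - Hc (lamOf t)) p.1‖ ≤ l₁ * ‖s - t‖)
    -- the datum
    (hDA : Bd2 L η k Ω (fun y => covDivB η U₀ A y) cDA)
    (hA : ∀ j, j ≤ k → ∀ x ∈ Ω j, ∀ μ : Fin d,
      wt L η j * ‖A x μ‖ ≤ cA ∧ wt L η j * ‖conjR (U₀ (x - e μ) μ)⁻¹ (A (x - e μ) μ)‖ ≤ cA)
    -- Sect. E (1.114) in its converse printed use
    (h114q : ∀ s : lamSubK η U₀ L k Eb, ‖s‖ ≤ α₄ / 4 →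
      Cond179 L k Λs U₀ (gaugeExp (lamOf s + Hc (lamOf s)))⁻¹ u₁⁻¹ → q (lamOf s) = 0)
    -- the candidate solution
    {lam : Site d → 𝔸} (hlρ : ∀ x, ‖lam x‖ ≤ ρ)
    (hDρ : ∀ j, j ≤ k → ∀ p ∈ Eb j, wt L η j * ‖covDerivFwd η U₀ p.2 lam p.1‖ ≤ ρ)
    (hmult : ∃ μ : ℕ → Site d → 𝔸, ∀ x ∈ Ω 0,
      covLap η U₀ ((Ω 0).indicator fun y => covDivB η U₀ A y + covLap η U₀ lam y +
        ((conjR (gaugeExp lam y)⁻¹ (covDivB η U₀ A y) - covDivB η U₀ A y) +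
          (gAd (covLap η U₀ lam y) (lam y) - covLap η U₀ lam y) + ∑ μ, frakF3 η U₀ lam A y μ)) x = QT L k Λs U₀ μ x)
    (h179 : Cond179 L k Λs U₀ (gaugeExp lam)⁻¹ u₁⁻¹) :
    ∃ t : lamSubK η U₀ L k Eb, ‖t‖ ≤ α₄ / 4 ∧ lamOf t + Hc (lamOf t) = lam ∧
      lamOf t = g (PsiP5 η U₀ A (fun y => covDivB η U₀ A y) (fun f => f - g (qs (c (q (g f)))))
        (fun l => l + Hc l) (fun l => covLap η U₀ (Hc l)) (lamOf t)) := by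
  have huniv : ∀ x, x ∈ Ω 0 := fun x => by rw [hΩ0]; exact Set.mem_univ x
  -- the letter R of (1.95)
  set R : (Site d → 𝔸) → (Site d → 𝔸) := fun f => f - g (qs (c (q (g f)))) with hRdef
  have hR : ∀ f, R f = f - g (qs (c (q (g f)))) := fun f => rfl
  have hRsub : ∀ f f' : Site d → 𝔸, R (f - f') = R f - R f' := proj325_sub (R := R) hR
  have hR0 : R 0 = 0 := by rw [hR]; simp
  have hRneg : ∀ f : Site d → 𝔸, R (-f) = -R f := fun f => by rw [← zero_sub, hRsub, hR0, zero_sub]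
  have hRadd : ∀ f f' : Site d → 𝔸, R (f + f') = R f + R f' := fun f f' => by
    have h := hRsub (f + f') f'
    rw [add_sub_cancel_right] at h
    rw [h, sub_add_cancel]
  -- Step 1: the inverse change of variables
  obtain ⟨t, ht, hgp⟩ := sectE_inverse_kLevel hη Hc hh₀ hl₀' hl₁' hρ₀ hρ₁ hc0 hc1 hcL0 hcL1 hlρ hDρ
  -- sizes of λ′ = λ_t + H_cλ_t
  have hρ0 : 0 ≤ ρ := (norm_nonneg _).trans (hlρ 0)
  have ha12 : ∀ x, ‖lam x‖ ≤ 1 / 12 := fun x => (hlρ x).trans (by linarith)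
  have hlam_a : ∀ x, ‖lam x‖ ≤ α₄ / 4 + h₀ := fun x => by rw [← hgp]; exact gpar_size hc0 t ht x
  have ha12' : α₄ / 4 + h₀ ≤ 1 / 12 := by linarith
  have hgrad : ∀ j, j ≤ k → ∀ x ∈ Ω j, ∀ μ : Fin d,
      wt L η j * ‖covDerivFwd η U₀ μ lam x‖ ≤ α₄ / 4 + h₁ ∧ wt L η j * ‖covDeriv η U₀ μ lam x‖ ≤ α₄ / 4 + h₁ := by
    intro j hj x hx μ
    rw [← hgp]
    exact gpar_grad hη hU₀ hEbΩ hc1 t ht hj hx μ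
  -- the Neumann data at λ′
  have hVsub : ∀ f f' : Site d → 𝔸, ∀ j, j ≤ k → ∀ x ∈ Ω j, Vop lam f x - Vop lam f' x = Vop lam (f - f') x :=
    fun f f' j _ x _ => Vop_sub f f' (ha12 x)
  have hVbd : ∀ f : Site d → 𝔸, ∀ j, j ≤ k → ∀ x ∈ Ω j, ‖Vop lam f x‖ ≤ 10 * (α₄ / 4 + h₀) * ‖f x‖ :=
    fun f j _ x _ => norm_Vop_le f (hlam_a x) ha12'
  have hcV : 0 ≤ 10 * (α₄ / 4 + h₀) := by linarith
  set mW := mWc d (α₄ / 4 + h₁) cA h₂ cDA with hmWdef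
  have hmW : 0 ≤ mW := mWc_nonneg hb₁.le hcA hh₂ hcDA
  set W : Site d → 𝔸 := Wsrc η U₀ A (fun y => covDivB η U₀ A y) lam (covLap η U₀ (Hc (lamOf t))) with hWdef
  have hW : Bd2 L η k Ω W mW := fun j hj x hx =>
    wt_sq_norm_Wsrc_le hL hη (by linarith : α₄ / 4 + h₁ ≤ 1 / 70) hcA (by linarith : cA ≤ 1 / 12) (ha12 x) (hgrad j hj x hx)
      (hA j hj x hx) (hc2 t ht j hj x hx) (hDA j hj x hx)
  set Z : Site d → 𝔸 := Zsol W (Vop lam) R with hZdef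
  have hZeq : ∀ j, j ≤ k → ∀ x ∈ Ω j, Z x + Vop lam (R Z) x = W x :=
    fun j hj x hx => zsol_eq hL hη hVsub hVbd hRsub hRbd hW hcV hBR hmW hθ hj hx
  have hZbd : Bd2 L η k Ω Z (2 * mW) := bd2_zsol hL hη hVsub hVbd hRsub hRbd hW hcV hBR hmW hθ
  -- Step 2: `Q′λ_t = 0` from (1.79) for the inverse pair and (1.114)
  have hq0 : q (lamOf t) = 0 := h114q t ht (by rw [hgp]; exact h179)
  -- Step 3: `R N = 0` for the right-hand side `N` of the D*-identity, from the multiplier clause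
  set N : Site d → 𝔸 := fun y => covDivB η U₀ A y + covLap η U₀ lam y +
    ((conjR (gaugeExp lam y)⁻¹ (covDivB η U₀ A y) - covDivB η U₀ A y) +
      (gAd (covLap η U₀ lam y) (lam y) - covLap η U₀ lam y) + ∑ μ, frakF3 η U₀ lam A y μ) with hNdef
  obtain ⟨μ, hμ⟩ := hmult
  have hΔN : Δ N = qs μ := funext fun x => by
    rw [hΔ N x (huniv x), hqs μ x (huniv x)]
    exact hμ x (huniv x)
  -- Step 4: `N = W + (Δλ_t + V Δλ_t)` (the D*-identity's right-hand side regrouped at λ′ = λ_t − (−H_cλ_t))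
  set Y : Site d → 𝔸 := covLap η U₀ (lamOf t) with hYdef
  have hdef : lam = lamOf t - (-Hc (lamOf t)) := by rw [sub_neg_eq_add, hgp]
  have hNW : N = W + (Y + Vop lam Y) := funext fun y => by
    have h := dstar_rhs_eq_W_add (η := η) U₀ A hdef (ha12 y)
    rw [covLap_neg', gAd_neg _ (ha12 y), sub_neg_eq_add] at h
    exact h
  -- (W8″ guard) `N` is a BOUNDED function: `Bd2`-bounded through `W`, `Δλ_t`, `VΔλ_t`, hence sup-bounded as `Ω 0 = univ`
  have hNbd2 : Bd2 L η k Ω N (mW + (2 * d * (L : ℝ) ^ k * ‖t‖ + 10 * (α₄ / 4 + h₀) * (2 * d * (L : ℝ) ^ k * ‖t‖))) := by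
    have hY : Bd2 L η k Ω Y (2 * d * (L : ℝ) ^ k * ‖t‖) := bd2_covLap_lamOf hL hη hU₀ hEbΩ t
    have hVY : Bd2 L η k Ω (Vop lam Y) (10 * (α₄ / 4 + h₀) * (2 * d * (L : ℝ) ^ k * ‖t‖)) := fun j hj x hx => by
      calc wt L η j ^ 2 * ‖Vop lam Y x‖ ≤ wt L η j ^ 2 * (10 * (α₄ / 4 + h₀) * ‖Y x‖) :=
            mul_le_mul_of_nonneg_left (hVbd Y j hj x hx) (sq_nonneg _)
        _ = 10 * (α₄ / 4 + h₀) * (wt L η j ^ 2 * ‖Y x‖) := by ring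
        _ ≤ 10 * (α₄ / 4 + h₀) * (2 * d * (L : ℝ) ^ k * ‖t‖) := mul_le_mul_of_nonneg_left (hY j hj x hx) hcV
    rw [hNW]
    exact hW.add (hY.add hVY)
  have hNbdd : ∃ C : ℝ, ∀ y, ‖N y‖ ≤ C :=
    ⟨_, fun y => hNbd2.norm_le hL hη (Nat.zero_le _) (huniv y)⟩
  have hRN : R N = 0 :=
    proj325_eq_zero_of_multiplier_guarded g Δ q qs Aw c (P := fun x : Site d → 𝔸 => ∃ C : ℝ, ∀ y, ‖x y‖ ≤ C) g_leftB c_left' hNbdd hΔN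
  -- Step 5: `RΔλ_t = Δλ_t`, and the Neumann identity, give `Δλ_t = −RZ`
  have hYΔ : Y = Δ (lamOf t) := funext fun x => by
    rw [hΔ _ x (huniv x), hΩ0, Set.indicator_univ]
  have hgY : g Y = lamOf t := by
    have h := g_leftB (lamOf t) ⟨‖t‖, norm_lamOf_le t⟩
    rw [hq0, map_zero, map_zero, add_zero, ← hYΔ] at h
    exact h
  have hRY : R Y = Y := by
    rw [hR, hgY, hq0, map_zero, map_zero, map_zero, sub_zero]
  have hVadd : ∀ f f' : Site d → 𝔸, Vop lam (f + f') = Vop lam f + Vop lam f' := fun f f' => by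
    funext x
    have h := Vop_sub (a := lam) (f + f') f' (ha12 x)
    rw [add_sub_cancel_right] at h
    rw [Pi.add_apply, ← h, sub_add_cancel]
  have hWfun : W = Z + Vop lam (R Z) := funext fun x => by
    rw [Pi.add_apply]
    exact (hZeq 0 (Nat.zero_le _) x (huniv x)).symm
  set D : Site d → 𝔸 := Y + R Z with hDdef
  have hDeq : D = -R (Vop lam D) := by
    have h1 : R Z + R (Vop lam (R Z)) + (Y + R (Vop lam Y)) = 0 := by
      calc R Z + R (Vop lam (R Z)) + (Y + R (Vop lam Y)) = R N := by rw [hNW, hRadd, hRadd, hWfun, hRadd, hRY]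
        _ = 0 := hRN
    have h2 : R (Vop lam D) = R (Vop lam Y) + R (Vop lam (R Z)) := by rw [hDdef, hVadd, hRadd]
    have h3 : (Y + R Z) + (R (Vop lam Y) + R (Vop lam (R Z))) = 0 := by rw [← h1]; abel
    rw [h2]
    exact eq_neg_of_add_eq_zero_left h3
  have hDbd : Bd2 L η k Ω D (2 * d * (L : ℝ) ^ k * ‖t‖ + BR * (2 * mW)) :=
    (bd2_covLap_lamOf hL hη hU₀ hEbΩ t).add (hRbd Z (2 * mW) (by positivity) hZbd)
  have hD0 : ∀ j, j ≤ k → ∀ x ∈ Ω j, D x = 0 :=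
    neumann_injective hL hη hVbd hRbd hcV (by positivity) hθ hDbd fun j _ x _ => congrFun hDeq x
  have hYRZ : Y = -R Z := funext fun x => by
    have h : Y x + R Z x = 0 := hD0 0 (Nat.zero_le _) x (huniv x)
    rw [Pi.neg_apply]
    exact eq_neg_of_add_eq_zero_left h
  -- Step 6: the fixed-point equation (1.100): `λ_t = G′Δλ_t = G′R(−Z)`
  have hΔt : Δ (lamOf t) = R (fun x => -Z x) := by
    rw [← hYΔ, hYRZ, ← hRneg]
    rfl
  have hfix : lamOf t = g (R (fun x => -Z x)) := by
    have h := g_leftB (lamOf t) ⟨‖t‖, norm_lamOf_le t⟩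
    rw [hq0, map_zero, map_zero, add_zero, hΔt] at h
    exact h.symm
  refine ⟨t, ht, hgp, ?_⟩
  simp only [PsiP5, hgp]
  exact hfix


/-- **PROPOSITION 5, THE UNIQUENESS CLAUSE (1.109), AT `k` LEVELS, ROUTE-AGNOSTIC, LEFT-INVERSE LAW ON BOUNDED FUNCTIONS** —
`B8Prop5UniqKLevel.hFP_unique_of_cond179` VERBATIM with `g_left` ↦ `g_leftB` (see `isFixedPoint_of_cond179_bdd`): two site functions `λ′₁, λ′₂`,
each with `‖λ′ᵢ‖ ≤ ρ` everywhere and `(Lʲη)‖D^η_{U₀}λ′ᵢ‖ ≤ ρ` on the `Eb j`, each obeying the multiplier clause of `HFP` and (1.79) for its inverse pair,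
ARE EQUAL — both are `λ_s + H_cλ_s` for THE fixed point `s` of `propFive_fixedPoint_kLevel`.  `ρ` = print's c₃.
[cite: Balaban1985RegularSpaces, Prop. 5 (1.109) p.94, p.94 (after (1.106)), (1.100) p.93; Balaban1985BackgroundPropagators, Thm 3.1 p.397] -/
theorem hFP_unique_of_cond179_bdd (hL : 1 ≤ L) (hη : 0 < η) (hU₀ : ∀ x κ, U₀ x κ ∈ unitaryUnits 𝔸) (hΩ0 : Ω 0 = Set.univ)
    (hEbΩ : ∀ j, j ≤ k → ∀ x ∈ Ω j, ∀ μ : Fin d, (x, μ) ∈ Eb j ∧ (x - e μ, μ) ∈ Eb j)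
    -- letters of [4]
    (g Δ : (Site d → 𝔸) →ₗ[ℂ] (Site d → 𝔸)) (q : (Site d → 𝔸) →ₗ[ℂ] (ℕ → Site d → 𝔸)) (qs : (ℕ → Site d → 𝔸) →ₗ[ℂ] (Site d → 𝔸))
    (Aw c : (ℕ → Site d → 𝔸) →ₗ[ℂ] (ℕ → Site d → 𝔸))
    (g_leftB : ∀ x : Site d → 𝔸, (∃ C : ℝ, ∀ y, ‖x y‖ ≤ C) → g (Δ x + qs (Aw (q x))) = x)
    (c_left' : ∀ φ, qs (c (q (g (g (qs φ))))) = qs φ)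
    (hΔ : ∀ (f : Site d → 𝔸), ∀ x ∈ Ω 0, Δ f x = covLap η U₀ ((Ω 0).indicator f) x)
    (hqs : ∀ (μ : ℕ → Site d → 𝔸), ∀ x ∈ Ω 0, qs μ x = QT L k Λs U₀ μ x)
    -- the Sect. E correction `H_c` (λ′ = λ + H_c λ) and the windows
    (Hc : (Site d → 𝔸) → (Site d → 𝔸))
    {α₄ BG BR h₀ h₁ h₂ l₀ l₁ l₂ cA cDA ρ : ℝ}
    (hα₄ : 0 ≤ α₄) (hBG : 0 ≤ BG) (hBR : 0 ≤ BR) (hh₀ : 0 ≤ h₀) (hh₂ : 0 ≤ h₂) (hl₀ : 0 ≤ l₀) (hl₁ : 0 ≤ l₁) (hl₂ : 0 ≤ l₂)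
    (hcA : 0 ≤ cA) (hcA' : cA ≤ 1 / 13) (hcDA : 0 ≤ cDA)
    (ha₁' : α₄ / 4 + h₀ ≤ 1 / 24) (hb₁' : α₄ / 4 + h₁ ≤ 1 / 140) (hb₁ : 0 < α₄ / 4 + h₁) (hθ : 10 * (α₄ / 4 + h₀) * BR ≤ 1 / 2)
    (hl₀' : l₀ ≤ 1 / 2) (hl₁' : l₁ ≤ 1 / 2) (hρ₀ : ρ + h₀ ≤ α₄ / 4) (hρ₁ : ρ + h₁ ≤ α₄ / 4)
    -- (1.101) for G′, (1.98)R
    (hG : ∀ (f : Site d → 𝔸) (m : ℝ), 0 ≤ m → Bd2 L η k Ω f m →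
      (∀ x, ‖g f x‖ ≤ BG * m) ∧ ∀ j, j ≤ k → ∀ p ∈ Eb j, wt L η j * ‖covDerivFwd η U₀ p.2 (g f) p.1‖ ≤ BG * m)
    (hRbd : ∀ (f : Site d → 𝔸) (m : ℝ), 0 ≤ m → Bd2 L η k Ω f m → Bd2 L η k Ω (f - g (qs (c (q (g f))))) (BR * m))
    -- the binders of `H_c`
    (hc0 : ∀ s : lamSubK η U₀ L k Eb, ‖s‖ ≤ α₄ / 4 → ∀ x, ‖Hc (lamOf s) x‖ ≤ h₀)
    (hc1 : ∀ s : lamSubK η U₀ L k Eb, ‖s‖ ≤ α₄ / 4 → ∀ j, j ≤ k → ∀ p ∈ Eb j, wt L η j * ‖covDerivFwd η U₀ p.2 (Hc (lamOf s)) p.1‖ ≤ h₁)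
    (hc2 : ∀ s : lamSubK η U₀ L k Eb, ‖s‖ ≤ α₄ / 4 → Bd2 L η k Ω (covLap η U₀ (Hc (lamOf s))) h₂)
    (hcL0 : ∀ s t : lamSubK η U₀ L k Eb, ‖s‖ ≤ α₄ / 4 → ‖t‖ ≤ α₄ / 4 → ∀ x, ‖Hc (lamOf s) x - Hc (lamOf t) x‖ ≤ l₀ * ‖s - t‖)
    (hcL1 : ∀ s t : lamSubK η U₀ L k Eb, ‖s‖ ≤ α₄ / 4 → ‖t‖ ≤ α₄ / 4 → ∀ j, j ≤ k → ∀ p ∈ Eb j,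
      wt L η j * ‖covDerivFwd η U₀ p.2 (Hc (lamOf s) - Hc (lamOf t)) p.1‖ ≤ l₁ * ‖s - t‖)
    (hcL2 : ∀ s t : lamSubK η U₀ L k Eb, ‖s‖ ≤ α₄ / 4 → ‖t‖ ≤ α₄ / 4 →
      Bd2 L η k Ω (covLap η U₀ (Hc (lamOf s)) - covLap η U₀ (Hc (lamOf t))) (l₂ * ‖s - t‖))
    -- the datum
    (hDA : Bd2 L η k Ω (fun y => covDivB η U₀ A y) cDA)
    (hA : ∀ j, j ≤ k → ∀ x ∈ Ω j, ∀ μ : Fin d,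
      wt L η j * ‖A x μ‖ ≤ cA ∧ wt L η j * ‖conjR (U₀ (x - e μ) μ)⁻¹ (A (x - e μ) μ)‖ ≤ cA)
    -- smallness (1.103)/(1.106)
    (h103 : BG * Mc d BR (α₄ / 4 + h₁) cA h₂ cDA ≤ α₄ / 4)
    (h106 : BG * Kc d BR (α₄ / 4 + h₁) cA h₂ cDA l₂ (1 + l₀) (1 + l₁) ≤ 1 / 2)
    -- Sect. E (1.114) in its converse printed use
    (h114q : ∀ s : lamSubK η U₀ L k Eb, ‖s‖ ≤ α₄ / 4 →
      Cond179 L k Λs U₀ (gaugeExp (lamOf s + Hc (lamOf s)))⁻¹ u₁⁻¹ → q (lamOf s) = 0)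
    -- the two solutions
    {lam₁ lam₂ : Site d → 𝔸}
    (hl₁ : ∀ x, ‖lam₁ x‖ ≤ ρ) (hD₁ : ∀ j, j ≤ k → ∀ p ∈ Eb j, wt L η j * ‖covDerivFwd η U₀ p.2 lam₁ p.1‖ ≤ ρ)
    (hmult₁ : ∃ μ : ℕ → Site d → 𝔸, ∀ x ∈ Ω 0,
      covLap η U₀ ((Ω 0).indicator fun y => covDivB η U₀ A y + covLap η U₀ lam₁ y +
        ((conjR (gaugeExp lam₁ y)⁻¹ (covDivB η U₀ A y) - covDivB η U₀ A y) +
          (gAd (covLap η U₀ lam₁ y) (lam₁ y) - covLap η U₀ lam₁ y) + ∑ μ, frakF3 η U₀ lam₁ A y μ)) x = QT L k Λs U₀ μ x)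
    (h179₁ : Cond179 L k Λs U₀ (gaugeExp lam₁)⁻¹ u₁⁻¹)
    (hl₂' : ∀ x, ‖lam₂ x‖ ≤ ρ) (hD₂ : ∀ j, j ≤ k → ∀ p ∈ Eb j, wt L η j * ‖covDerivFwd η U₀ p.2 lam₂ p.1‖ ≤ ρ)
    (hmult₂ : ∃ μ : ℕ → Site d → 𝔸, ∀ x ∈ Ω 0,
      covLap η U₀ ((Ω 0).indicator fun y => covDivB η U₀ A y + covLap η U₀ lam₂ y +
        ((conjR (gaugeExp lam₂ y)⁻¹ (covDivB η U₀ A y) - covDivB η U₀ A y) +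
          (gAd (covLap η U₀ lam₂ y) (lam₂ y) - covLap η U₀ lam₂ y) + ∑ μ, frakF3 η U₀ lam₂ A y μ)) x = QT L k Λs U₀ μ x)
    (h179₂ : Cond179 L k Λs U₀ (gaugeExp lam₂)⁻¹ u₁⁻¹) :
    lam₁ = lam₂ := by
  obtain ⟨t₁, ht₁, hgp₁, hfix₁⟩ := isFixedPoint_of_cond179_bdd hL hη hU₀ hΩ0 hEbΩ g Δ q qs Aw c g_leftB c_left' hΔ hqs Hc hBR hh₀ hh₂ hcA
    hcA' hcDA ha₁' hb₁' hb₁ hθ hl₀' hl₁' hρ₀ hρ₁ hRbd hc0 hc1 hc2 hcL0 hcL1 hDA hA h114q hl₁ hD₁ hmult₁ h179₁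
  obtain ⟨t₂, ht₂, hgp₂, hfix₂⟩ := isFixedPoint_of_cond179_bdd hL hη hU₀ hΩ0 hEbΩ g Δ q qs Aw c g_leftB c_left' hΔ hqs Hc hBR hh₀ hh₂ hcA
    hcA' hcDA ha₁' hb₁' hb₁ hθ hl₀' hl₁' hρ₀ hρ₁ hRbd hc0 hc1 hc2 hcL0 hcL1 hDA hA h114q hl₂' hD₂ hmult₂ h179₂
  -- the letter R and the displayed maps of the contraction
  set R : (Site d → 𝔸) → (Site d → 𝔸) := fun f => f - g (qs (c (q (g f)))) with hRdef
  have hR : ∀ f, R f = f - g (qs (c (q (g f)))) := fun f => rfl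
  have hRsub : ∀ f f' : Site d → 𝔸, R (f - f') = R f - R f' := proj325_sub (R := R) hR
  set gpar : (Site d → 𝔸) → (Site d → 𝔸) := fun lam => lam + Hc lam with hgpar
  set Eterm : (Site d → 𝔸) → (Site d → 𝔸) := fun lam => covLap η U₀ (Hc lam) with hEterm
  have hg0 : ∀ s : lamSubK η U₀ L k Eb, ‖s‖ ≤ α₄ / 4 → ∀ j, j ≤ k → ∀ x ∈ Ω j, ‖gpar (lamOf s) x‖ ≤ α₄ / 4 + h₀ :=
    fun s hs j _ x _ => gpar_size hc0 s hs x
  have hg1 : ∀ s : lamSubK η U₀ L k Eb, ‖s‖ ≤ α₄ / 4 → ∀ j, j ≤ k → ∀ x ∈ Ω j, ∀ μ : Fin d,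
      wt L η j * ‖covDerivFwd η U₀ μ (gpar (lamOf s)) x‖ ≤ α₄ / 4 + h₁ ∧ wt L η j * ‖covDeriv η U₀ μ (gpar (lamOf s)) x‖ ≤ α₄ / 4 + h₁ :=
    fun s hs j hj x hx μ => gpar_grad hη hU₀ hEbΩ hc1 s hs hj hx μ
  have hgL : ∀ s t : lamSubK η U₀ L k Eb, ‖s‖ ≤ α₄ / 4 → ‖t‖ ≤ α₄ / 4 → ∀ j, j ≤ k → ∀ x ∈ Ω j,
      ‖gpar (lamOf s) x - gpar (lamOf t) x‖ ≤ (1 + l₀) * ‖s - t‖ ∧ ∀ μ : Fin d,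
        wt L η j * ‖covDerivFwd η U₀ μ (gpar (lamOf s) - gpar (lamOf t)) x‖ ≤ (1 + l₁) * ‖s - t‖ ∧
        wt L η j * ‖covDeriv η U₀ μ (gpar (lamOf s) - gpar (lamOf t)) x‖ ≤ (1 + l₁) * ‖s - t‖ :=
    fun s t hs ht j hj x hx => gpar_lip hη hU₀ hEbΩ hcL0 hcL1 s t hs ht hj hx
  have hE0 : ∀ s : lamSubK η U₀ L k Eb, ‖s‖ ≤ α₄ / 4 → Bd2 L η k Ω (Eterm (lamOf s)) h₂ := fun s hs => hc2 s hs
  have hEL : ∀ s t : lamSubK η U₀ L k Eb, ‖s‖ ≤ α₄ / 4 → ‖t‖ ≤ α₄ / 4 →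
      Bd2 L η k Ω (Eterm (lamOf s) - Eterm (lamOf t)) (l₂ * ‖s - t‖) := fun s t hs ht => hcL2 s t hs ht
  -- the ∃! of the contraction
  obtain ⟨s, -, huniq⟩ := propFive_fixedPoint_kLevel (Ω := Ω) (Eb := Eb) (U₀ := U₀) (A := A) (DA := fun y => covDivB η U₀ A y) hL hη
    (⇑g) R gpar Eterm hα₄ hBG hBR (by positivity) ha₁' hb₁ hb₁' hcA hcA' hcDA hh₂ hl₂ (by positivity) (by positivity) hθ hG
    (fun f f' => map_sub g f f') hRsub hRbd hg0 hg1 hgL hE0 hEL hDA hA h103 h106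
  have e₁ : t₁ = s := huniq t₁ ⟨ht₁, hfix₁⟩
  have e₂ : t₂ = s := huniq t₂ ⟨ht₂, hfix₂⟩
  rw [← hgp₁, ← hgp₂, e₁, e₂]

end Converse179B

#print axioms proj325_eq_zero_of_multiplier_guarded
#print axioms isFixedPoint_of_cond179_bdd
#print axioms hFP_unique_of_cond179_bdd

end Literature.MathematicalPhysics.QuantumFieldTheory.Balaban1983to89.B8Prop5UniqKLevelB

end
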